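/-
Copyright (c) 2026 the pub-hodgecm-mathlib formalisation cell (harness21).  Prover seat hodgecm-mathlib-LH4-p06 (g5), Track A «(D-RAM) FOUR-FRAME», unit U2H, census leaf
(ρ2b′-X) `stub_U2H_fixedPointCensus_typeTwo_unit0` — SOCKET (C) `orderCountCensusC` (type RamM), hand (C-2TOPfar) of ★ `toricCensusSum_ramM_v2` on the ODD-CLASS
diagonal (`jλ + 1 = m + s0`; LH4-p04 (g5) SOCKET (C) LEAD LINE #6 (3)).  2026-09-04.
-/
import Summits.HodgeConjecture.HodgeConjecture.Theorems.F0P3cDyRamToricLevelCensusRamMTopCellsOdd    -- (C-2TOP-odd, this seat): `oddBit_iff_censusBit`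
import Summits.HodgeConjecture.HodgeConjecture.Theorems.F0P3cDyRamToricLevelCensusRamMTopCells       -- ★ p858102 (this seat): `ncard_levelSetDep_top_cast_eq_of_bit`
import HarnessLib

/-!
# T5c (C-2TOPfar, odd-class diagonal): `#levelSetDep = if 2j + (g+s0) ≤ 2jλ + 1 ∧ side then 2·q^{j − (k′+1)∕2} else 0` on the FAR top cells of the rows `jλ + 1 = m + s0`

Cell `hodgecm-mathlib` (D-0151), FLOOR 0, crux H413 = `stmt-HodgeConjecture-24833`; squad F0∕P3c∕LH4; lane `--supports stmt-HodgeConjecture-24833 --as helper` (count-neutral).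
THEOREMS ONLY (no `def`, no instance, no notation, no `sorry`, default heartbeats).  Socket served: LH4-p04 (g5)'s SOCKET (C), T5s-RamM EDITION 2 letter `hvTopFar` on the realised
OFF-PARITY rows (`jλ + 1 = m + s0`, ★ S6b-RM), complementing ★ p858168 (even-class diagonal): for the `+` table (`η = (ρh∕h)·t(α^{k₀})` the diagonal class of the hyperbolic
scalar, in the odd shell) and the `−` table (`η′ = η·ψ(n₀)·t(ω_r)`, the anisotropic scalar's class), on `¬GEN`, `j + m = jλ + a`, `¬(j + a + 2 ≤ m + s0 + 2g)`:
**`(#levelSetDep_h(j,a;λ−u) : ℚ) = if 2j + (g+s0) ≤ 2jλ + 1 ∧ SideP then 2·q^{j − (j+a−m−s0+1)∕2} else 0`**, and the `h′` twin with `SideM` — ★ p857711's bytes with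
`SideP := (ε = 1)`, `SideM := (ε = −1)`.  Proof = ★ `ncard_levelSetDep_top_cast_eq_of_bit` × `oddBit_iff_censusBit` (the relative letter is used in both orientations via
`ψ(n₀)² = t(n₀)`, §1).
HONEST LABEL.  Count-neutral (`--supports`); unconditional local algebra; nothing of (ρ2b′-X) is asserted — `HC_CM` is proved only modulo the 7 printed citations (2 remaining named
inputs: hLiu418 = `stmt-HodgeConjecture-24832`, h413 = `stmt-HodgeConjecture-24833`) until rung 0 closes.

## References
* [Flicker1998UnitaryFL] Y. Z. Flicker, *Elementary proof of the fundamental lemma for a unitary group*, Canad. J. Math. 50 (1998): Prop. 7 p. 84.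
* [Kottwitz1986BaseChangeUnits] R. E. Kottwitz, *Base change for unit elements of Hecke algebras*, Compositio Math. 60 (1986): §1 pp. 240–241.
* [Serre1979] J.-P. Serre, *Local Fields*, GTM 67 (1979): Ch. V §3 Prop. 5, Cor. 3; Ch. X §1.
-/

set_option autoImplicit false

noncomputable section

namespace Summit.HodgeConjecture.HodgeConjecture.Cruxes.H413.F0P3cDyRamToricLevelCensusRamM

open WithZero IsLocalRing
open scoped Valued
open Literature.NumberTheory.Automorphic.UnitaryThreeFourFrame (IsRamifiedQuadraticDatum)
open Literature.NumberTheory.LocalFields.QuadraticOrder Literature.NumberTheory.LocalFields.WildQuadraticDatum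
open Summit.HodgeConjecture.HodgeConjecture.Cruxes.H413.F0P3cDyRamToricCensusDefs

variable {K : Type} [Field K] [Valued K ℤᵐ⁰] {ρ Θ τ : K →+* K} {α ϖE h h' : K} {dρ t dτ tτ : ℕ}
variable {K' : Type*} [Field K'] [Valued K' ℤᵐ⁰] {σ' : K' →+* K'} {π' : K'} {d' : ℕ}

/-! ## §1 The diagonal class is in `T♮`; the relative letter in the other orientation -/

omit [Valued K ℤᵐ⁰] in
/-- The diagonal class `η = (ρh∕h)·t(α^{k₀})` is `Θ`-fixed when `Θh = h`. [cite: Serre1979, Ch. V §3] -/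
theorem theta_classMult (hΘΘ : ∀ x, Θ (Θ x) = x) (hΘρ : ∀ x, Θ (ρ x) = ρ (Θ x)) (hΘh : Θ h = h) (k₀ : ℤ) :
    Θ (ρ h / h * (ρ (α ^ k₀ * Θ (α ^ k₀)) / (α ^ k₀ * Θ (α ^ k₀)))) = ρ h / h * (ρ (α ^ k₀ * Θ (α ^ k₀)) / (α ^ k₀ * Θ (α ^ k₀))) := by
  simp only [map_mul, map_div₀, hΘρ, hΘh, hΘΘ]; ring

omit [Valued K ℤᵐ⁰] in
/-- The diagonal class has `η·ρη = 1`. [cite: Serre1979, Ch. V §3] -/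
theorem classMult_mul_map (hρρ : ∀ x, ρ (ρ x) = x) (hh : h ≠ 0) (hα0 : α ≠ 0) (hΘα0 : ∀ k : ℤ, Θ (α ^ k) ≠ 0) (k₀ : ℤ) :
    ρ h / h * (ρ (α ^ k₀ * Θ (α ^ k₀)) / (α ^ k₀ * Θ (α ^ k₀))) * ρ (ρ h / h * (ρ (α ^ k₀ * Θ (α ^ k₀)) / (α ^ k₀ * Θ (α ^ k₀)))) = 1 := by
  have hρh : ρ h ≠ 0 := (map_ne_zero ρ).2 hh
  have hN : α ^ k₀ * Θ (α ^ k₀) ≠ 0 := mul_ne_zero (zpow_ne_zero k₀ hα0) (hΘα0 k₀)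
  have hρN : ρ (α ^ k₀ * Θ (α ^ k₀)) ≠ 0 := (map_ne_zero ρ).2 hN
  have hΘk := hΘα0 k₀
  have hαk : α ^ k₀ ≠ 0 := zpow_ne_zero k₀ hα0
  rw [map_mul ρ (ρ h / h), map_div₀ ρ (ρ h) h, map_div₀ ρ (ρ (α ^ k₀ * Θ (α ^ k₀))), hρρ, hρρ]
  field_simp

/-- **THE RELATIVE LETTER IN THE OTHER ORIENTATION**: `η′ = η·ψ(n₀)·t(ω_r)` gives `η = η′·ψ(n₀)·t((n₀ω_r)⁻¹)` (`ψ(n₀)² = t(n₀)` for `Θ`-fixed `n₀`). [cite: Serre1979, Ch. V §3] -/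
theorem rel_symm_of_rel {n₀ : K} (hΘn₀ : Θ n₀ = n₀) (hn₀0 : n₀ ≠ 0) (hn₀1 : Valued.v n₀ = 1)
    {η η' : K} {ω_r : Kˣ} (hω_r : Valued.v (ω_r : K) = 1) (hη0 : η ≠ 0)
    (hrel : η' = η * (ρ n₀ / n₀) * (ρ ((ω_r : K) * Θ ω_r) / ((ω_r : K) * Θ ω_r))) :
    ∃ ω' : Kˣ, Valued.v (ω' : K) = 1 ∧ η = η' * (ρ n₀ / n₀) * (ρ ((ω' : K) * Θ ω') / ((ω' : K) * Θ ω')) := by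
  have hne : (n₀ * (ω_r : K))⁻¹ ≠ 0 := inv_ne_zero (mul_ne_zero hn₀0 ω_r.ne_zero)
  refine ⟨Units.mk0 _ hne, by rw [Units.val_mk0, map_inv₀, map_mul, hn₀1, hω_r, one_mul, inv_one], ?_⟩
  rw [Units.val_mk0, normTwist_inv, hrel]
  have hρn₀ : ρ n₀ ≠ 0 := (map_ne_zero ρ).2 hn₀0
  have hΘω : Θ (ω_r : K) ≠ 0 := (map_ne_zero Θ).2 ω_r.ne_zero
  have hρω : ρ (ω_r : K) ≠ 0 := (map_ne_zero ρ).2 ω_r.ne_zero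
  have hρΘω : ρ (Θ (ω_r : K)) ≠ 0 := (map_ne_zero ρ).2 hΘω
  simp only [map_mul, hΘn₀]
  field_simp

/-! ## §2 `hvTopFar` on the odd-class diagonal -/

/-- **`hvTopFar`, THE `+` TABLE, ODD-CLASS DIAGONAL.**  Frame of ★ p858131 plus the off-parity regime `jλ + 1 = m + s0`, `g + s0 ≤ m + 1`, and the odd-class letters of the diagonal
class `η = (ρh∕h)·t(α^{k₀})` (`|1 + η| ≤ exp(2−2d′)`, `¬ |1 + η| ≤ exp(−2d′)`; `Θh = h`) with its partner `η′` (`η′ = η·ψ(n₀)·t(ω_r)`); side letters at `c″ = s0 + 2g − 1` in the literal-bit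
currency of ★ `oddBit_iff_censusBit`. [cite: Flicker1998UnitaryFL, Prop. 7 p. 84] [cite: Kottwitz1986BaseChangeUnits, §1 pp. 240–241] [cite: Serre1979, Ch. V §3 Prop. 5, Cor. 3] -/
theorem ncard_levelSetDep_far_cast_eq_of_oddClass [CompleteSpace K] [IsDiscreteValuationRing 𝒪[K]] [Finite 𝓀[K]]
    [IsDiscreteValuationRing 𝒪[K']] [Finite 𝓀[K']]
    (hD : IsRamifiedQuadraticDatum ρ α dρ t) (hΘρ : ∀ x, Θ (ρ x) = ρ (Θ x)) (hvΘ : ∀ x, Valued.v (Θ x) = Valued.v x)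
    (hτ : ∀ x, τ x = Θ (ρ x)) (hDτ : IsRamifiedQuadraticDatum τ α dτ tτ)
    {P : K} (hτP : τ P = P) (hP : Valued.v P = exp (-2 : ℤ)) {dK : ℕ} (hdK : Valued.v (P - ρ P) = exp (-(2 * (dK : ℤ))))
    (hσ' : ∀ x, σ' (σ' x) = x) (hvσ' : ∀ x, Valued.v (σ' x) = Valued.v x) (hfix' : ∀ x : K', σ' x = x → x ≠ 0 → ∃ n : ℤ, Valued.v x = exp (2 * n))
    (hπ' : Valued.v π' = exp (-1 : ℤ)) (hdd' : Valued.v (π' - σ' π') = Valued.v π' ^ d')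
    (jK : K' →+* K) (hjle : ∀ x y : K', Valued.v (jK x) ≤ Valued.v (jK y) ↔ Valued.v x ≤ Valued.v y) (hjΘ : ∀ x, Θ (jK x) = jK x)
    (hjfix : ∀ z : K, Θ z = z → ∃ x, jK x = z) (hjσ : ∀ x, jK (σ' x) = ρ (jK x)) (hjπ : Valued.v (jK π') = exp (-2 : ℤ))
    {ϖ : K} {dΘ tΘ : ℕ} (hDΘ : IsRamifiedQuadraticDatum Θ ϖ dΘ tΘ)
    (hFN : ∀ f : K, ρ f = f → Θ f = f → Valued.v f = 1 → ∃ x : K, x * Θ x = f)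
    {n₀ : K} (hΘn₀ : Θ n₀ = n₀) (hn₀1 : Valued.v n₀ = 1) (hn₀N : ¬ ∃ z : K, z * Θ z = n₀)
    (hϖE : Valued.v ϖE = exp (-2 : ℤ)) (hρϖ : ρ ϖE = ϖE) {q : ℕ} (hq : Nat.card 𝓀[K] = q) (hq' : Nat.card 𝓀[K'] = q) (hq2 : 2 ∣ q)
    (hΘh : Θ h = h) (hh : h ≠ 0) {vh : ℤ} (hvh : Valued.v h = exp (-vh))
    {lam u : K} (hlam : lam * Θ lam = 1) (hu : ρ u = u) (hu1 : u * Θ u = 1)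
    {m jl : ℕ} (hμ : Valued.v (lam - u) = Valued.v ϖE ^ m) (hjl : Valued.v ((lam - u) - ρ (lam - u)) = Valued.v (ϖE ^ jl * (α - ρ α)))
    {g s0 : ℕ} (hg : dΘ = 2 * g) (hs0 : dτ = 2 * s0) (hd' : 2 * d' = dρ + dτ) (hdK2 : 2 * dK = dρ + 2 * g)
    (hoff : jl + 1 = m + s0) (hmd : g + s0 ≤ m + 1)
    {k₀ : ℤ} (hk₀ : vh + dρ + 2 * k₀ + 2 * jl = 2 * m)
    (hηsh : Valued.v (1 + ρ h / h * (ρ (α ^ k₀ * Θ (α ^ k₀)) / (α ^ k₀ * Θ (α ^ k₀)))) ≤ exp (-(2 * (d' : ℤ) - 2)))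
    (hodd : ¬ Valued.v (1 + ρ h / h * (ρ (α ^ k₀ * Θ (α ^ k₀)) / (α ^ k₀ * Θ (α ^ k₀)))) ≤ exp (-(2 * (d' : ℤ))))
    {η' : K} {ω_r : Kˣ} (hω_r : Valued.v (ω_r : K) = 1)
    (hrel : η' = ρ h / h * (ρ (α ^ k₀ * Θ (α ^ k₀)) / (α ^ k₀ * Θ (α ^ k₀))) * (ρ n₀ / n₀) * (ρ ((ω_r : K) * Θ ω_r) / ((ω_r : K) * Θ ω_r)))
    (SideP : Prop) [Decidable SideP] (SideM : Prop)
    (hSP : (∃ ω₁ : Kˣ, Valued.v (ω₁ : K) = 1 ∧ Valued.v (1 + ρ h / h * (ρ (α ^ k₀ * Θ (α ^ k₀)) / (α ^ k₀ * Θ (α ^ k₀))) / (ρ (lam - u) / (lam - u)) *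
      (ρ ((ω₁ : K) * Θ ω₁) / ((ω₁ : K) * Θ ω₁))) ≤ exp (-(2 * ((s0 : ℤ) + 2 * g - 1) + dρ))) → SideP)
    (hSM : (∃ ω₁ : Kˣ, Valued.v (ω₁ : K) = 1 ∧ Valued.v (1 + η' / (ρ (lam - u) / (lam - u)) * (ρ ((ω₁ : K) * Θ ω₁) / ((ω₁ : K) * Θ ω₁))) ≤
      exp (-(2 * ((s0 : ℤ) + 2 * g - 1) + dρ))) → SideM)
    (hPM : ¬ (SideP ∧ SideM))
    {j a : ℕ} (hj : j ≤ jl) (hng : ¬ (a ≤ m ∧ (j + a ≤ m ∨ (2 * a ≤ m ∧ j + a ≤ jl)))) (hdiag : j + m = jl + a)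
    (hfar : ¬ (j + a + 2 ≤ m + s0 + 2 * g)) :
    ((levelSetDep ρ Θ α ϖE h j a (lam - u)).ncard : ℚ) =
      if 2 * j + (g + s0) ≤ 2 * jl + 1 ∧ SideP then 2 * (q : ℚ) ^ (j - (j + a - m - s0 + 1) / 2) else 0 := by
  obtain ⟨hρρ, -, hα, -, -, -, -⟩ := id hD
  have hΘΘ := hDΘ.1
  have hg1 : 1 ≤ g := by have h1 := hDΘ.2.2.2.2.2.1; omega
  have hα0 : α ≠ 0 := fun h0 => by rw [h0, map_zero] at hα; exact exp_ne_zero hα.symm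
  have hΘη := theta_classMult (α := α) hΘΘ hΘρ hΘh k₀
  have hη1 := classMult_mul_map (Θ := Θ) hρρ hh hα0 (fun k => (map_ne_zero Θ).2 (zpow_ne_zero k hα0)) k₀
  have hbit : (∃ ω₁ : Kˣ, Valued.v (ω₁ : K) = 1 ∧
      Valued.v (1 + ρ h / h * (ρ (α ^ k₀ * Θ (α ^ k₀)) / (α ^ k₀ * Θ (α ^ k₀))) / (ρ (lam - u) / (lam - u)) * (ρ ((ω₁ : K) * Θ ω₁) / ((ω₁ : K) * Θ ω₁))) ≤
        exp (2 * (m : ℤ) - 2 * a - 2 * j - dρ)) ↔ 2 * j + (g + s0) ≤ 2 * jl + 1 ∧ (j + a + 2 ≤ m + s0 + 2 * g ∨ SideP) := by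
    rw [show (2 * (m : ℤ) - 2 * a - 2 * j - dρ) = -(2 * ((j + a - m : ℕ) : ℤ) + dρ) by omega,
      oddBit_iff_censusBit hD hΘρ hvΘ hτ hDτ hτP hP hdK hσ' hvσ' hfix' hπ' hdd' jK hjle hjΘ hjfix hjσ hjπ hDΘ hFN hΘn₀ hn₀1 hn₀N hϖE hlam hu hu1 hμ hjl
        hg hs0 hd' hdK2 hoff hmd hΘη hη1 hηsh hodd hω_r hrel SideP SideM hSP hSM hPM (j + a - m)]
    constructor <;> rintro ⟨h1, h2⟩ <;> exact ⟨by omega, h2.imp_left fun h3 => by omega⟩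
  have hval := ncard_levelSetDep_top_cast_eq_of_bit hD hΘρ hvΘ hϖE hρϖ hq hq' hq2 hσ' hvσ' hfix' hπ' hdd' jK hjle hjΘ hjfix hjσ hjπ hDΘ hFN hh hvh hμ hjl hg hs0 hd'
    hk₀ hj hng hdiag _ hbit
  rw [hval, if_neg (show ¬ (j + a < m + s0) by omega), if_pos (show 2 * g ≤ j + a - m - s0 + 1 by omega)]
  by_cases hb : 2 * j + (g + s0) ≤ 2 * jl + 1 ∧ SideP
  · rw [if_pos hb, if_pos ⟨hb.1, Or.inr hb.2⟩]
  · rw [if_neg hb, if_neg (fun h2 => hb ⟨h2.1, h2.2.resolve_left hfar⟩)]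

/-- **`hvTopFar`, THE `−` TABLE, ODD-CLASS DIAGONAL**: the partner class `η′ = (ρh′∕h′)·t(α^{k₀′}) = η·ψ(n₀)·t(ω_r)` of the scalar `h′` (`Θh′ = h′`), same letters:
`(#levelSetDep_{h′}(j,a;λ−u) : ℚ) = if 2j + (g+s0) ≤ 2jλ + 1 ∧ SideM then 2·q^{j − (k′+1)∕2} else 0`. [cite: Flicker1998UnitaryFL, Prop. 7 p. 84] [cite: Serre1979, Ch. V §3 Prop. 5, Cor. 3] -/
theorem ncard_levelSetDep_far_cast_eq_of_oddClass_partner [CompleteSpace K] [IsDiscreteValuationRing 𝒪[K]] [Finite 𝓀[K]]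
    [IsDiscreteValuationRing 𝒪[K']] [Finite 𝓀[K']]
    (hD : IsRamifiedQuadraticDatum ρ α dρ t) (hΘρ : ∀ x, Θ (ρ x) = ρ (Θ x)) (hvΘ : ∀ x, Valued.v (Θ x) = Valued.v x)
    (hτ : ∀ x, τ x = Θ (ρ x)) (hDτ : IsRamifiedQuadraticDatum τ α dτ tτ)
    {P : K} (hτP : τ P = P) (hP : Valued.v P = exp (-2 : ℤ)) {dK : ℕ} (hdK : Valued.v (P - ρ P) = exp (-(2 * (dK : ℤ))))
    (hσ' : ∀ x, σ' (σ' x) = x) (hvσ' : ∀ x, Valued.v (σ' x) = Valued.v x) (hfix' : ∀ x : K', σ' x = x → x ≠ 0 → ∃ n : ℤ, Valued.v x = exp (2 * n))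
    (hπ' : Valued.v π' = exp (-1 : ℤ)) (hdd' : Valued.v (π' - σ' π') = Valued.v π' ^ d')
    (jK : K' →+* K) (hjle : ∀ x y : K', Valued.v (jK x) ≤ Valued.v (jK y) ↔ Valued.v x ≤ Valued.v y) (hjΘ : ∀ x, Θ (jK x) = jK x)
    (hjfix : ∀ z : K, Θ z = z → ∃ x, jK x = z) (hjσ : ∀ x, jK (σ' x) = ρ (jK x)) (hjπ : Valued.v (jK π') = exp (-2 : ℤ))
    {ϖ : K} {dΘ tΘ : ℕ} (hDΘ : IsRamifiedQuadraticDatum Θ ϖ dΘ tΘ)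
    (hFN : ∀ f : K, ρ f = f → Θ f = f → Valued.v f = 1 → ∃ x : K, x * Θ x = f)
    {n₀ : K} (hΘn₀ : Θ n₀ = n₀) (hn₀1 : Valued.v n₀ = 1) (hn₀N : ¬ ∃ z : K, z * Θ z = n₀)
    (hϖE : Valued.v ϖE = exp (-2 : ℤ)) (hρϖ : ρ ϖE = ϖE) {q : ℕ} (hq : Nat.card 𝓀[K] = q) (hq' : Nat.card 𝓀[K'] = q) (hq2 : 2 ∣ q)
    (hh : h ≠ 0) (hΘh' : Θ h' = h') (hh' : h' ≠ 0) {vh' : ℤ} (hvh' : Valued.v h' = exp (-vh'))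
    {lam u : K} (hlam : lam * Θ lam = 1) (hu : ρ u = u) (hu1 : u * Θ u = 1)
    {m jl : ℕ} (hμ : Valued.v (lam - u) = Valued.v ϖE ^ m) (hjl : Valued.v ((lam - u) - ρ (lam - u)) = Valued.v (ϖE ^ jl * (α - ρ α)))
    {g s0 : ℕ} (hg : dΘ = 2 * g) (hs0 : dτ = 2 * s0) (hd' : 2 * d' = dρ + dτ) (hdK2 : 2 * dK = dρ + 2 * g)
    (hoff : jl + 1 = m + s0) (hmd : g + s0 ≤ m + 1)
    {k₀ k₀' : ℤ} (hk₀' : vh' + dρ + 2 * k₀' + 2 * jl = 2 * m)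
    (hηsh' : Valued.v (1 + ρ h' / h' * (ρ (α ^ k₀' * Θ (α ^ k₀')) / (α ^ k₀' * Θ (α ^ k₀')))) ≤ exp (-(2 * (d' : ℤ) - 2)))
    (hodd' : ¬ Valued.v (1 + ρ h' / h' * (ρ (α ^ k₀' * Θ (α ^ k₀')) / (α ^ k₀' * Θ (α ^ k₀')))) ≤ exp (-(2 * (d' : ℤ))))
    {ω_r : Kˣ} (hω_r : Valued.v (ω_r : K) = 1)
    (hrel : ρ h' / h' * (ρ (α ^ k₀' * Θ (α ^ k₀')) / (α ^ k₀' * Θ (α ^ k₀'))) =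
      ρ h / h * (ρ (α ^ k₀ * Θ (α ^ k₀)) / (α ^ k₀ * Θ (α ^ k₀))) * (ρ n₀ / n₀) * (ρ ((ω_r : K) * Θ ω_r) / ((ω_r : K) * Θ ω_r)))
    (SideP SideM : Prop) [Decidable SideM]
    (hSP : (∃ ω₁ : Kˣ, Valued.v (ω₁ : K) = 1 ∧ Valued.v (1 + ρ h / h * (ρ (α ^ k₀ * Θ (α ^ k₀)) / (α ^ k₀ * Θ (α ^ k₀))) / (ρ (lam - u) / (lam - u)) *
      (ρ ((ω₁ : K) * Θ ω₁) / ((ω₁ : K) * Θ ω₁))) ≤ exp (-(2 * ((s0 : ℤ) + 2 * g - 1) + dρ))) → SideP)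
    (hSM : (∃ ω₁ : Kˣ, Valued.v (ω₁ : K) = 1 ∧ Valued.v (1 + ρ h' / h' * (ρ (α ^ k₀' * Θ (α ^ k₀')) / (α ^ k₀' * Θ (α ^ k₀'))) / (ρ (lam - u) / (lam - u)) *
      (ρ ((ω₁ : K) * Θ ω₁) / ((ω₁ : K) * Θ ω₁))) ≤ exp (-(2 * ((s0 : ℤ) + 2 * g - 1) + dρ))) → SideM)
    (hPM : ¬ (SideP ∧ SideM))
    {j a : ℕ} (hj : j ≤ jl) (hng : ¬ (a ≤ m ∧ (j + a ≤ m ∨ (2 * a ≤ m ∧ j + a ≤ jl)))) (hdiag : j + m = jl + a)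
    (hfar : ¬ (j + a + 2 ≤ m + s0 + 2 * g)) :
    ((levelSetDep ρ Θ α ϖE h' j a (lam - u)).ncard : ℚ) =
      if 2 * j + (g + s0) ≤ 2 * jl + 1 ∧ SideM then 2 * (q : ℚ) ^ (j - (j + a - m - s0 + 1) / 2) else 0 := by
  obtain ⟨hρρ, -, hα, -, -, -, -⟩ := id hD
  have hΘΘ := hDΘ.1
  have hg1 : 1 ≤ g := by have h1 := hDΘ.2.2.2.2.2.1; omega
  have hα0 : α ≠ 0 := fun h0 => by rw [h0, map_zero] at hα; exact exp_ne_zero hα.symm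
  have hΘα0 : ∀ k : ℤ, Θ (α ^ k) ≠ 0 := fun k => (map_ne_zero Θ).2 (zpow_ne_zero k hα0)
  have hΘη' := theta_classMult (α := α) hΘΘ hΘρ hΘh' k₀'
  have hη'1 := classMult_mul_map (Θ := Θ) hρρ hh' hα0 hΘα0 k₀'
  have hn₀0 : n₀ ≠ 0 := fun h0 => by rw [h0, map_zero] at hn₀1; exact zero_ne_one hn₀1
  have hη0 : ρ h / h * (ρ (α ^ k₀ * Θ (α ^ k₀)) / (α ^ k₀ * Θ (α ^ k₀))) ≠ 0 := by
    have h1 := classMult_mul_map (Θ := Θ) hρρ hh hα0 hΘα0 k₀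
    exact left_ne_zero_of_mul_eq_one h1
  obtain ⟨ω', hω', hrel'⟩ := rel_symm_of_rel (Θ := Θ) hΘn₀ hn₀0 hn₀1 hω_r hη0 hrel
  have hPM' : ¬ (SideM ∧ SideP) := fun h1 => hPM ⟨h1.2, h1.1⟩
  have hbit : (∃ ω₁ : Kˣ, Valued.v (ω₁ : K) = 1 ∧
      Valued.v (1 + ρ h' / h' * (ρ (α ^ k₀' * Θ (α ^ k₀')) / (α ^ k₀' * Θ (α ^ k₀'))) / (ρ (lam - u) / (lam - u)) * (ρ ((ω₁ : K) * Θ ω₁) / ((ω₁ : K) * Θ ω₁))) ≤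
        exp (2 * (m : ℤ) - 2 * a - 2 * j - dρ)) ↔ 2 * j + (g + s0) ≤ 2 * jl + 1 ∧ (j + a + 2 ≤ m + s0 + 2 * g ∨ SideM) := by
    rw [show (2 * (m : ℤ) - 2 * a - 2 * j - dρ) = -(2 * ((j + a - m : ℕ) : ℤ) + dρ) by omega,
      oddBit_iff_censusBit hD hΘρ hvΘ hτ hDτ hτP hP hdK hσ' hvσ' hfix' hπ' hdd' jK hjle hjΘ hjfix hjσ hjπ hDΘ hFN hΘn₀ hn₀1 hn₀N hϖE hlam hu hu1 hμ hjl
        hg hs0 hd' hdK2 hoff hmd hΘη' hη'1 hηsh' hodd' hω' hrel' SideM SideP hSM hSP hPM' (j + a - m)]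
    constructor <;> rintro ⟨h1, h2⟩ <;> exact ⟨by omega, h2.imp_left fun h3 => by omega⟩
  have hval := ncard_levelSetDep_top_cast_eq_of_bit hD hΘρ hvΘ hϖE hρϖ hq hq' hq2 hσ' hvσ' hfix' hπ' hdd' jK hjle hjΘ hjfix hjσ hjπ hDΘ hFN hh' hvh' hμ hjl hg hs0 hd'
    hk₀' hj hng hdiag _ hbit
  rw [hval, if_neg (show ¬ (j + a < m + s0) by omega), if_pos (show 2 * g ≤ j + a - m - s0 + 1 by omega)]
  by_cases hb : 2 * j + (g + s0) ≤ 2 * jl + 1 ∧ SideM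
  · rw [if_pos hb, if_pos ⟨hb.1, Or.inr hb.2⟩]
  · rw [if_neg hb, if_neg (fun h2 => hb ⟨h2.1, h2.2.resolve_left hfar⟩)]

end Summit.HodgeConjecture.HodgeConjecture.Cruxes.H413.F0P3cDyRamToricLevelCensusRamM

end
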